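import Summits.Ventures.PercRepro.S4MidKeyElevenFifteenP1
import Summits.Ventures.PercRepro.S4MidKeyElevenFifteenP2
import Summits.Ventures.PercRepro.S4MidKeyElevenFifteenP3
import Summits.Ventures.PercRepro.S4MidKeyElevenFifteenP4
import Summits.Ventures.PercRepro.S4MidKeyElevenFifteenP5
import Summits.Ventures.PercRepro.S4MidKeyElevenFifteenP6

/-!
# PercRepro — THE MIDDLE KEY AT LEVEL `11`, RANK `15` — COMBINER 1 OF 1 (p1 g48, S4 feeder — p9 owns SUBCLAIM-S4; no window claim here)

Part of the middle key at rank `15`, level `11` (n₀ = 1296, 3 layers; p1 g48): the certificate of proofs/P1-HYPKEY.md §16–§18 split DIAGONALLY —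
the rows of every layer grouped by size into windows, the two big sums of the key (`#U ≤ Σ_k m[k,q]`, the `Y`-rows) split into unexpanded chunk sums
that each window's part expands locally — so that every `linear_combination` stays under the gate's 600-second verification limit (§16 (e)).
Nothing is claimed below `n₀`. Axioms: standard.
-/

open scoped Matroid

namespace PercRepro

namespace S4Mid

open Set Finset S2LP S3Mid

variable {α : Type}

set_option maxHeartbeats 64000000 in
set_option maxRecDepth 20000 in
set_option linter.unusedSimpArgs false in
/-- Combiner `1` of the middle key at rank `15`, level `11`: the sum of part 1, part 2, part 3, part 4, part 5, part 6. -/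
theorem c025_core_eleven_midkey_fifteen_c1 (M : Matroid α) [M.Finite] (hn : 1296 ≤ M.E.ncard)
    (hfree : ∀ e ∈ M.E, ∃ A ⊆ M.E \ {e}, e ∉ M.closure A ∧ e ∉ M.closure ((M.E \ {e}) \ A)) :
    (50 / 13) * ∑ i ∈ Finset.range 250, ((S1.rkSets M (11 + i) 11).ncard : ℚ) + (50 / 13) * ∑ i ∈ Finset.range 250, ((S1.rkSets M (11 + (250 + i)) 11).ncard : ℚ) + (50 / 13) * ∑ i ∈ Finset.range 172, ((S1.rkSets M (11 + (500 + i)) 11).ncard : ℚ) + (50 / 13) * ∑ i ∈ Finset.range 250, ((S1.rkSets M (11 + (672 + i)) 11).ncard : ℚ) + (50 / 13) * ∑ i ∈ Finset.range 250, ((S1.rkSets M (11 + (922 + i)) 11).ncard : ℚ) + (50 / 13) * ∑ i ∈ Finset.range 97, ((S1.rkSets M (11 + (1172 + i)) 11).ncard : ℚ) + (-1) * ∑ i ∈ Finset.range 249, ((S1.rkSets M (12 + i) 12).ncard : ℚ) + (-1) * ∑ i ∈ Finset.range 250, ((S1.rkSets M (12 + (249 + i)) 12).ncard : ℚ) + (-1)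 * ∑ i ∈ Finset.range 172, ((S1.rkSets M (12 + (499 + i)) 12).ncard : ℚ) + (-1) * ∑ i ∈ Finset.range 61, ((S1.rkSets M (12 + (671 + i)) 12).ncard : ℚ) + (-1) * ∑ i ∈ Finset.range 112, ((S1.rkSets M (571 + i) 13).ncard : ℚ) + (-1) * ∑ i ∈ Finset.range 61, ((S1.rkSets M (571 + (112 + i)) 13).ncard : ℚ) + (-1) * ∑ i ∈ Finset.range 108, ((S1.rkSets M (575 + i) 14).ncard : ℚ) + (-1) * ∑ i ∈ Finset.range 48, ((S1.rkSets M (575 + (108 + i)) 14).ncard : ℚ) ≤ 0 := by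
  have hP1 := c025_core_eleven_midkey_fifteen_p1 M hn hfree
  have hP2 := c025_core_eleven_midkey_fifteen_p2 M hn hfree
  have hP3 := c025_core_eleven_midkey_fifteen_p3 M hn hfree
  have hP4 := c025_core_eleven_midkey_fifteen_p4 M hn hfree
  have hP5 := c025_core_eleven_midkey_fifteen_p5 M hn hfree
  have hP6 := c025_core_eleven_midkey_fifteen_p6 M hn hfree
  linear_combination ((1 * hP1 + (1 * hP2 + 1 * hP3)) + (1 * hP4 + (1 * hP5 + 1 * hP6)))

end S4Mid

end PercRepro
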